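import Summits.AnomalousDissipation.AnomalousDissipation.Theorems.DenseLoudDesignerForces.Negative.WindowBounds
import Summits.AnomalousDissipation.AnomalousDissipation.Theorems.LaminarNeverLoud.Negative.StokesArc
import Literature.Analysis.FluidPDE.LongTimeAveragePeriodic
import Literature.Analysis.FluidPDE.LerayProjectorTorusProofs
import Literature.Analysis.FluidPDE.NSGalerkinFourier
import Literature.Analysis.FluidPDE.EulerReynolds
import Literature.Analysis.FunctionSpaces.TorusFourierModes
import Literature.Analysis.FunctionSpaces.TorusSpaceTime

/-!
# `BaireTransfer.RobustLoudSomewhere` (stmt-AnomalousDissipation-1150) — proved by the laminar single-mode witness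

The support item `RobustLoudSomewhere` of route `BaireTransfer` reads
`∃ E ε > 0, ∀ j, ∃ S, interior LOUD_j(S,E,ε) ≠ ∅`, with the frequency set `S` quantified AFTER the level `j`.
As observed by the route's refuter review (evidence `TRIVIAL_1150.md` on the item), this order lets a
level-dependent SINGLE shear mode close the statement by an exact laminar (Kolmogorov/Stokes) steady state;
this file is the kernel-checked version of that remark.

Construction.  Budgets `E = 2`, `ε = 1`.  At level `j` take the single frequency `k = (0, K, 0)`,
`K = j + 1`, so `S_j = {k}` and `P_{S_j} = (↥{k} → ℂ³)`, and the viscosity `ν_K = 1/(4π²K²) < 1/(j+1)`.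
For EVERY coefficient vector `c` the designer force is the transversal single real mode
`f_c(x) = Re (e_k(x) • z_c)`, `z_c = P_k c_k ⊥ k` (`force_apply`), hence
`(f_c·∇) f_c = 0` (`convect_force`: `f_c ⊥ e₂` and `f_c` depends on `x₂` only) and `Δ f_c = -4π²K² f_c`,
so `u := f_c`, `p := 0` is an exact steady classical solution of `NS_{ν_K}` forced by `f_c`
(`laminar_isClassical`), with `meanEnergy = meanDissipation = ‖z_c‖²/2` (finite Parseval on the
symmetric representation `f_c = realTrigPoly {k,-k} (z_c/2, z̄_c/2)`).  Consequently
`LOUD_j ⊇ {c : 2 < ‖z_c‖² < 4}`, an open set (continuity of the Leray multiplier) containing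
`c ≡ √3 e₁`; so `interior LOUD_j ≠ ∅` at every level.

The objects are those of the sibling negative-knowledge files (`DenseLoudDesignerForces.Negative.force/loudSet`,
verbatim the route's force and loud set, so the closing theorem is by `rfl`-unfolding; the shear frequency
`LaminarNeverLoud.Negative.kol`, two-sided set `shearModes` and unit vector `e0`).  The four `def`s below
(`modeSet`, `pol`, `symCoeff`, `nuK`) are proof-local abbreviations of this witness, not new notions.

References: Robinson–Rodrigo–Sadowski 2016 §2.1/§4.1 (single Stokes eigen-modes on `T³`); Doering–Foias 2002 §2
(the functionals); the refuter evidence `TRIVIAL_1150.md` (route review 92e48819, 2026-08-15).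
-/

-- `Summit.<Summit>.<Problem>` is the tree's mandated summit-side namespace (CONVENTIONS §2); for this
-- single-conjunct summit the two coincide, so the duplicate is deliberate.
set_option linter.dupNamespace false

noncomputable section

namespace Summit.AnomalousDissipation.AnomalousDissipation.Theorems.RobustLoudSomewhere

open scoped BigOperators Topology ENNReal ComplexConjugate
open Filter Set MeasureTheory UnitAddTorus
open Literature.Analysis.FunctionSpaces Literature.Analysis.FunctionSpaces.Torus
open Literature.Analysis.FunctionSpaces.EuclideanSpace (realPart conjVec)
open Literature.Analysis.FluidPDE Literature.Analysis.FluidPDE.Torus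
open Summit.AnomalousDissipation.AnomalousDissipation.Theses.BaireTransfer
open Summit.AnomalousDissipation.AnomalousDissipation.Theorems.DenseLoudDesignerForces
open Summit.AnomalousDissipation.AnomalousDissipation.Theorems.LaminarNeverLoud.Negative
  (kol kol_apply kol_ne_zero kol_ne_neg freqNormSq_kol e0 e0_apply norm_e0 shearModes shearModes_symm)

/-- The flat unit torus `T³`. -/
local notation "𝕋³" => UnitAddTorus (Fin 3)
/-- Complex Fourier coefficients. -/
local notation "ℂ³" => EuclideanSpace ℂ (Fin 3)

/-! ## §1 The single-mode coefficient space and the polarisation `z_c = P_k c_k` -/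

/-- The single frequency set `S_K = {(0,K,0)}`. [folklore] -/
def modeSet (K : ℤ) : Finset (Fin 3 → ℤ) := {kol K}

/-- `(0,K,0) ∈ S_K`. [folklore] -/
theorem kol_mem (K : ℤ) : kol K ∈ modeSet K := Finset.mem_singleton_self _

/-- The polarisation `z_c = P_k c_k` of the force `f_c`, `k = (0,K,0)` (the Leray multiplier applied to the one
coefficient). [folklore] -/
def pol (K : ℤ) (c : ↥(modeSet K) → ℂ³) : ℂ³ := Torus.lerayCoeff (kol K) (c ⟨kol K, kol_mem K⟩)

/-- `c ↦ z_c` is continuous. [folklore] -/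
theorem continuous_pol (K : ℤ) : Continuous (pol K) :=
  (Negative.continuous_lerayCoeff (kol K)).comp (continuous_apply _)

/-- Transversality `k · z_c = 0`. [folklore] -/
theorem sum_mul_pol {K : ℤ} (hK : K ≠ 0) (c : ↥(modeSet K) → ℂ³) :
    ∑ i, ((kol K i : ℤ) : ℂ) * pol K c i = 0 := by
  rw [pol, lerayCoeff_of_ne_zero (kol_ne_zero hK)]
  exact sum_mul_leraySym_apply _ _

/-- The polarisation has no `e₂`-component: `(z_c)₁ = 0`. [folklore] -/
theorem pol_apply_one {K : ℤ} (hK : K ≠ 0) (c : ↥(modeSet K) → ℂ³) : pol K c 1 = 0 := by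
  have h := sum_mul_pol hK c
  simp only [Fin.sum_univ_three, kol_apply] at h
  simpa [hK] using h

variable {K : ℤ}

/-- **The force is a single real mode**: `f_c(x) = Re (e_k(x) • z_c)`. [folklore] -/
theorem force_apply (c : ↥(modeSet K) → ℂ³) (x : 𝕋³) :
    Negative.force (modeSet K) c x = realPart (mFourier (kol K) x • pol K c) := by
  have h : realTrigPoly (modeSet K) (fun k => Torus.lerayCoeff k (coeffExt (modeSet K) c k)) x =
      realPart (mFourier (kol K) x • Torus.lerayCoeff (kol K) (coeffExt (modeSet K) c (kol K))) :=
    realTrigPoly_singleton_apply (kol K) _ x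
  rw [coeffExt_of_mem _ (kol_mem K)] at h
  exact h

/-- The force is orthogonal to `e₂`: `(f_c x)₁ = 0`. [folklore] -/
theorem force_apply_one (hK : K ≠ 0) (c : ↥(modeSet K) → ℂ³) (x : 𝕋³) :
    Negative.force (modeSet K) c x 1 = 0 := by
  rw [force_apply, EuclideanSpace.realPart_apply, PiLp.smul_apply, smul_eq_mul, pol_apply_one hK, mul_zero,
    Complex.zero_re]

/-- The force depends on `x₂` only: `∂ᵢ f_c = 0` for `i ≠ 1`. [folklore] -/
theorem partialDeriv_force_of_ne_one (c : ↥(modeSet K) → ℂ³) {i : Fin 3} (hi : i ≠ 1) (x : 𝕋³) :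
    partialDeriv i (Negative.force (modeSet K) c) x = 0 := by
  rw [Negative.force, partialDeriv_realTrigPoly]
  have h : realTrigPoly (modeSet K)
      (fun k => (2 * Real.pi * Complex.I * (k i : ℂ)) • Torus.lerayCoeff k (coeffExt (modeSet K) c k)) =
      realTrigPoly (modeSet K) 0 := by
    refine realTrigPoly_congr fun k hk => ?_
    rw [modeSet, Finset.mem_singleton] at hk
    subst hk
    simp [kol_apply, hi]
  rw [h, realTrigPoly_zero]
  rfl

/-- **No self-advection**: `(f_c·∇) f_c = 0`. [folklore] -/
theorem convect_force (hK : K ≠ 0) (c : ↥(modeSet K) → ℂ³) (x : 𝕋³) :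
    Torus.convect (Negative.force (modeSet K) c) (Negative.force (modeSet K) c) x = 0 := by
  have hC : IsContDiff 1 (Negative.force (modeSet K) c) := (Negative.isSmooth_force _ c).isContDiff (by simp)
  have hval : Negative.force (modeSet K) c x =
      (Negative.force (modeSet K) c x 0) • EuclideanSpace.single (0 : Fin 3) (1 : ℝ) +
        (Negative.force (modeSet K) c x 2) • EuclideanSpace.single (2 : Fin 3) (1 : ℝ) := by
    ext i
    fin_cases i
    · simp
    · simp [force_apply_one hK]
    · simp
  unfold Torus.convect
  rw [hval, map_add, map_smul, map_smul, ← partialDeriv_eq_fderiv_apply hC, ← partialDeriv_eq_fderiv_apply hC,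
    partialDeriv_force_of_ne_one c (by decide) x, partialDeriv_force_of_ne_one c (by decide) x, smul_zero,
    smul_zero, add_zero]

/-- The force is a Stokes eigenfield: `Δ f_c = -4π²K² f_c`. [folklore] -/
theorem laplacian_force (c : ↥(modeSet K) → ℂ³) (x : 𝕋³) :
    laplacian (Negative.force (modeSet K) c) x = -(4 * Real.pi ^ 2 * (K : ℝ) ^ 2) • Negative.force (modeSet K) c x := by
  have h := laplacian_realTrigPoly_singleton (kol K) (fun k => Torus.lerayCoeff k (coeffExt (modeSet K) c k)) x
  rw [freqNormSq_kol] at h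
  exact h

/-! ## §2 Budgets: the symmetric representation and finite Parseval -/

/-- Conjugate-symmetric coefficients of the single real mode `Re (e_k • z)`: `z/2` at `k`, `z̄/2` at `-k`.
[folklore] -/
def symCoeff (K : ℤ) (z : ℂ³) : (Fin 3 → ℤ) → ℂ³ := fun k =>
  if k = kol K then ((2⁻¹ : ℝ) : ℂ) • z else if k = -kol K then ((2⁻¹ : ℝ) : ℂ) • conjVec z else 0

/-- Value at `k`. [folklore] -/
theorem symCoeff_kol (z : ℂ³) : symCoeff K z (kol K) = ((2⁻¹ : ℝ) : ℂ) • z := by simp [symCoeff]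

/-- Value at `-k`. [folklore] -/
theorem symCoeff_neg_kol (hK : K ≠ 0) (z : ℂ³) : symCoeff K z (-kol K) = ((2⁻¹ : ℝ) : ℂ) • conjVec z := by
  simp [symCoeff, (kol_ne_neg hK).symm]

/-- The symmetric coefficients are conjugate symmetric. [folklore] -/
theorem isConjSymm_symCoeff (hK : K ≠ 0) (z : ℂ³) : IsConjSymm (symCoeff K z) := by
  intro k
  by_cases h1 : k = kol K
  · subst h1
    rw [symCoeff_neg_kol hK, symCoeff_kol, EuclideanSpace.conjVec_smul, Complex.conj_ofReal]
  by_cases h2 : k = -kol K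
  · subst h2
    rw [neg_neg, symCoeff_kol, symCoeff_neg_kol hK, EuclideanSpace.conjVec_smul, Complex.conj_ofReal,
      EuclideanSpace.conjVec_conjVec]
  · have h1' : -k ≠ kol K := fun h => h2 (by rw [← h, neg_neg])
    have h2' : -k ≠ -kol K := fun h => h1 (neg_injective h)
    simp [symCoeff, h1, h2, h1', h2', EuclideanSpace.conjVec_zero]

/-- **Symmetric representation**: `f_c = realTrigPoly {k,-k} (symCoeff z_c)` (the two-sided set `{k,-k}` is
the sibling file's `shearModes K`). [folklore] -/
theorem force_eq_sym (hK : K ≠ 0) (c : ↥(modeSet K) → ℂ³) :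
    Negative.force (modeSet K) c = realTrigPoly (shearModes K) (symCoeff K (pol K c)) := by
  funext x
  rw [force_apply, realTrigPoly_apply, trigPoly_apply, shearModes,
    Finset.sum_insert (by simp [kol_ne_neg hK] : kol K ∉ ({-kol K} : Finset (Fin 3 → ℤ))),
    Finset.sum_singleton, symCoeff_kol, symCoeff_neg_kol hK, map_add]
  have hconj : mFourier (-kol K) x • (((2⁻¹ : ℝ) : ℂ) • conjVec (pol K c)) =
      conjVec (mFourier (kol K) x • (((2⁻¹ : ℝ) : ℂ) • pol K c)) := by
    rw [EuclideanSpace.conjVec_smul, EuclideanSpace.conjVec_smul, Complex.conj_ofReal, mFourier_neg]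
  rw [hconj, EuclideanSpace.realPart_conjVec, ← two_smul ℝ, ← map_smul]
  congr 1
  ext i
  simp only [PiLp.smul_apply, smul_eq_mul, Complex.real_smul]
  push_cast
  ring

/-- `‖f_c‖₂² = ‖z_c‖²/2`. [folklore] -/
theorem integral_norm_sq_force (hK : K ≠ 0) (c : ↥(modeSet K) → ℂ³) :
    ∫ x, ‖Negative.force (modeSet K) c x‖ ^ 2 = ‖pol K c‖ ^ 2 / 2 := by
  rw [force_eq_sym hK, integral_norm_sq_realTrigPoly (shearModes_symm K) (isConjSymm_symCoeff hK _), shearModes,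
    Finset.sum_insert (by simp [kol_ne_neg hK] : kol K ∉ ({-kol K} : Finset (Fin 3 → ℤ))),
    Finset.sum_singleton, symCoeff_kol, symCoeff_neg_kol hK, norm_smul, norm_smul, EuclideanSpace.norm_conjVec,
    Complex.norm_real, Real.norm_eq_abs, abs_of_pos (by norm_num : (0 : ℝ) < 2⁻¹)]
  ring

/-- `‖∇f_c‖₂² = 2π²K²‖z_c‖²` (spectral). [folklore] -/
theorem eGradNormSq_force (hK : K ≠ 0) (c : ↥(modeSet K) → ℂ³) :
    eGradNormSq (Negative.force (modeSet K) c) = ENNReal.ofReal (2 * Real.pi ^ 2 * (K : ℝ) ^ 2 * ‖pol K c‖ ^ 2) := by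
  rw [force_eq_sym hK, eGradNormSq_realTrigPoly (shearModes_symm K) (isConjSymm_symCoeff hK _), shearModes,
    Finset.sum_insert (by simp [kol_ne_neg hK] : kol K ∉ ({-kol K} : Finset (Fin 3 → ℤ))),
    Finset.sum_singleton, symCoeff_kol, symCoeff_neg_kol hK, norm_smul, norm_smul, EuclideanSpace.norm_conjVec,
    Complex.norm_real, Real.norm_eq_abs, abs_of_pos (by norm_num : (0 : ℝ) < 2⁻¹), freqNormSq_neg,
    freqNormSq_kol]
  congr 1
  ring

/-! ## §3 The laminar steady state `u = f_c`, `p = 0` at `ν_K = 1/(4π²K²)` -/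

/-- The laminar viscosity `ν_K = 1/(4π²K²)` at which `u = f_c` solves `NS_ν(f_c)`. [folklore] -/
def nuK (K : ℤ) : ℝ := 1 / (4 * Real.pi ^ 2 * (K : ℝ) ^ 2)

/-- `ν_K > 0`. [folklore] -/
theorem nuK_pos (hK : K ≠ 0) : 0 < nuK K := by
  have : (K : ℝ) ≠ 0 := Int.cast_ne_zero.2 hK
  unfold nuK
  positivity

/-- **The laminar steady state is a classical solution**: `u = f_c`, `p = 0` solves `NS_{ν_K}` forced by `f_c`
(exactly: `ν_K Δ f_c = -f_c`, `(f_c·∇)f_c = 0`). [folklore] -/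
theorem laminar_isClassical (hK : K ≠ 0) (c : ↥(modeSet K) → ℂ³) :
    IsClassicalNSSolutionOn Set.univ (nuK K) (fun _ => Negative.force (modeSet K) c)
      (fun _ => Negative.force (modeSet K) c) (fun _ _ => 0) where
  smooth_velocity := isSmoothSpaceTimeOn_const (Negative.isSmooth_force _ c) _
  smooth_pressure := isSmoothSpaceTimeOn_const (isSmooth_const _) _
  momentum := fun t _ x => by
    have h0 : Torus.timeDerivWithin Set.univ (fun _ : ℝ => Negative.force (modeSet K) c) t x = 0 := by
      simp [Torus.timeDerivWithin]
    have hK' : (K : ℝ) ≠ 0 := Int.cast_ne_zero.2 hK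
    have hcoef : nuK K * -(4 * Real.pi ^ 2 * (K : ℝ) ^ 2) = -1 := by
      unfold nuK
      field_simp
    rw [h0, convect_force hK, laplacian_force, gradient_zero, sub_zero, zero_add, smul_smul, hcoef, neg_one_smul,
      neg_add_cancel]
  divFree := fun _ _ => Negative.isDivFree_force _ c

/-- Mean energy of the laminar state: `⟨‖u‖₂²⟩ = ‖z_c‖²/2`. [folklore] -/
theorem meanEnergy_laminar (hK : K ≠ 0) (c : ↥(modeSet K) → ℂ³) :
    meanEnergy (fun _ : ℝ => Negative.force (modeSet K) c) = ‖pol K c‖ ^ 2 / 2 := by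
  rw [meanEnergy_eq_of_periodic (τ := 1) (fun _ => rfl) one_pos]
  simp [integral_norm_sq_force hK]

/-- Mean dissipation of the laminar state: `⟨ν_K‖∇u‖₂²⟩ = ‖z_c‖²/2`. [folklore] -/
theorem meanDissipation_laminar (hK : K ≠ 0) (c : ↥(modeSet K) → ℂ³) :
    meanDissipation (nuK K) (fun _ : ℝ => Negative.force (modeSet K) c) = ‖pol K c‖ ^ 2 / 2 := by
  rw [meanDissipation_eq_of_periodic (τ := 1) (fun _ => rfl) one_pos]
  have hK' : (K : ℝ) ≠ 0 := Int.cast_ne_zero.2 hK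
  simp [eGradNormSq_force hK, ENNReal.toReal_ofReal
    (by positivity : (0 : ℝ) ≤ 2 * Real.pi ^ 2 * (K : ℝ) ^ 2 * ‖pol K c‖ ^ 2), nuK]
  field_simp
  ring

/-! ## §4 The open loud window `{c : 2 < ‖z_c‖² < 4}` -/

/-- The window `{c : 2 < ‖z_c‖² < 4}` is open (continuity of the Leray multiplier). [folklore] -/
theorem isOpen_window (K : ℤ) : IsOpen {c : ↥(modeSet K) → ℂ³ | 2 < ‖pol K c‖ ^ 2 ∧ ‖pol K c‖ ^ 2 < 4} := by
  have h : Continuous fun c : ↥(modeSet K) → ℂ³ => ‖pol K c‖ ^ 2 := (continuous_pol K).norm.pow 2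
  exact (isOpen_lt continuous_const h).inter (isOpen_lt h continuous_const)

/-- The window is non-empty: it contains `c ≡ √3 e₁` (`P_k (√3 e₁) = √3 e₁` since `e₁ ⊥ k`, of squared norm `3`).
[folklore] -/
theorem window_nonempty (hK : K ≠ 0) : {c : ↥(modeSet K) → ℂ³ | 2 < ‖pol K c‖ ^ 2 ∧ ‖pol K c‖ ^ 2 < 4}.Nonempty := by
  refine ⟨fun _ => ((Real.sqrt 3 : ℝ) : ℂ) • e0, ?_⟩
  have hpol : pol K (fun _ => ((Real.sqrt 3 : ℝ) : ℂ) • e0) = ((Real.sqrt 3 : ℝ) : ℂ) • e0 := by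
    rw [pol, lerayCoeff_of_ne_zero (kol_ne_zero hK)]
    refine leraySym_of_transversal ?_
    simp [kol_apply, e0_apply]
  have hnorm : ‖pol K (fun _ => ((Real.sqrt 3 : ℝ) : ℂ) • e0)‖ ^ 2 = 3 := by
    rw [hpol, norm_smul, norm_e0, mul_one, Complex.norm_real, Real.norm_eq_abs,
      abs_of_nonneg (Real.sqrt_nonneg 3), Real.sq_sqrt (by norm_num)]
  simp only [Set.mem_setOf_eq, hnorm]
  norm_num

/-- **The window is loud**: for `ν_K < 1/(j+1)`, every `c` in the window lies in `LOUD_j(S_K, 2, 1)`, witnessed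
by the laminar steady state. [folklore] -/
theorem window_subset_loudSet (hK : K ≠ 0) {j : ℕ} (hν : nuK K < 1 / ((j : ℝ) + 1)) :
    {c : ↥(modeSet K) → ℂ³ | 2 < ‖pol K c‖ ^ 2 ∧ ‖pol K c‖ ^ 2 < 4} ⊆ Negative.loudSet (modeSet K) 2 1 j := by
  intro c hc
  refine ⟨nuK K, nuK_pos hK, hν, 1, fun _ => Negative.force (modeSet K) c, fun _ _ => 0, one_pos,
    laminar_isClassical hK c, fun _ => rfl, ?_, ?_⟩
  · rw [meanEnergy_laminar hK]
    linarith [hc.2]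
  · rw [meanDissipation_laminar hK]
    linarith [hc.1]

/-- **Robust loudness at every level**: `interior LOUD_j(S_{j+1}, 2, 1) ≠ ∅`
(`ν_{j+1} = 1/(4π²(j+1)²) < 1/(j+1)`). [folklore] -/
theorem interior_loudSet_nonempty (j : ℕ) :
    (interior (Negative.loudSet (modeSet ((j : ℤ) + 1)) 2 1 j)).Nonempty := by
  have hK : ((j : ℤ) + 1) ≠ 0 := by omega
  have hν : nuK ((j : ℤ) + 1) < 1 / ((j : ℝ) + 1) := by
    unfold nuK
    rw [one_div_lt_one_div (by positivity) (by positivity)]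
    push_cast
    have h1 : (1 : ℝ) ≤ (j : ℝ) + 1 := by linarith [(Nat.cast_nonneg j : (0 : ℝ) ≤ (j : ℝ))]
    have h2 : (j : ℝ) + 1 ≤ ((j : ℝ) + 1) ^ 2 := by nlinarith
    have h3 : (9 : ℝ) < Real.pi ^ 2 := by nlinarith [Real.pi_gt_three]
    nlinarith
  obtain ⟨c, hc⟩ := window_nonempty hK
  exact ⟨c, interior_mono (window_subset_loudSet hK hν) (by rwa [(isOpen_window _).interior_eq])⟩

end Summit.AnomalousDissipation.AnomalousDissipation.Theorems.RobustLoudSomewhere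

/-- **Settles stmt-AnomalousDissipation-1150** (`BaireTransfer.RobustLoudSomewhere`, as typed): with budgets
`E = 2`, `ε = 1`, at every level `j` the single-mode family `S_j = {(0, j+1, 0)}` has robustly loud forces —
the whole open window `{c : 2 < ‖P_k c_k‖² < 4}` is loud by the exact laminar steady state `u = f_c` at
`ν = 1/(4π²(j+1)²)`.  (The statement carries no zeroth-law content because `S` is chosen after `j`; see the
module docstring.) [folklore] -/
theorem Summit.AnomalousDissipation.AnomalousDissipation.Theorems.RobustLoudSomewhere_proof :
    Summit.AnomalousDissipation.AnomalousDissipation.Theses.BaireTransfer.RobustLoudSomewhere :=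
  ⟨2, 1, one_pos, fun j =>
    ⟨Summit.AnomalousDissipation.AnomalousDissipation.Theorems.RobustLoudSomewhere.modeSet ((j : ℤ) + 1),
      Summit.AnomalousDissipation.AnomalousDissipation.Theorems.RobustLoudSomewhere.interior_loudSet_nonempty j⟩⟩

end
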